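import Literature.MathematicalPhysics.QuantumFieldTheory.Balaban1983to89.Node00.CriticalOnFibreTopHalving
import Literature.MathematicalPhysics.QuantumFieldTheory.Balaban1983to89.Node00.LocalGaugeCoDivergence

/-!
# BalabanUVNodes ∕ N07 — [15] SECT. F, THE LAST TWO SENTENCES OF THE ONE-STEP IMPROVEMENT AT THE OBJECTS OF RECORD: from «(167) in a local gauge around an
# arbitrary unit cube Δ₀» to «U_k belongs to the space (2) with max{B₃ε₁, ½ε₀} instead of ε₀» (p. 304) — the token `LocalLetters167TopStep F N Sup B₃ a₀ a₁`
# (the binder block of n07-e's `HalvingStepTop` byte for byte; conclusion = print's (167) in ∃-gauge form per plaquette ∕ per bond of the top class) ⇒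
# `HalvingStepTop F N Sup B₃ a₀ a₁`, and the (165) ⇒ (167) budget (print's (166) «a₅» and (162) «B₃») re-cut for the tree's (168) constants

Cell `pub-ymgap`, width seat `pub-ymgap-dag-n07-w4` (director-ym №197 ∕ HUMAN RULING D-0149), node N07 = [15] = T. Bałaban, *The variational problem and
background fields in renormalization group method for lattice gauge theories*, Commun. Math. Phys. **102** (1985) 277–309 [Balaban1985Variational]; [6] =
[Balaban1985RegularSpaces]; sub-target S6 of plan g77's `W-SEAT-START-LIST.md` v3 § n07 (= dag-n07-e g14's `W-SEAT-START-LIST-N07.md` item S6: «the ASSEMBLY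
(165)–(167) → (168) (DONE) → `HalvingStepTop` (module 30) → stub 1»).  NEW Theorems-side leaf (`--supports stmt-QuantumFields-20542 --as helper`; two `def … : Prop` tokens, NEVER asserted, one letter predicate, + theorems); CONSUMED BY
NAME, nothing modified: n07-e module 30 `Node00.CriticalOnFibreTopHalving` (`HalvingStepTop`), module 31 `Node00.LocalGaugePlaquette` (`plaqSmallOn_of_localGaugeOn`,
through 33c), 33b `Node00.LocalGaugeCoDivergenceLetters` (`Sect2.LocalGauge10On`, `Sect2.bondsDeep`), 33c `Node00.LocalGaugeCoDivergence`
(`Sect2.regularTwo_of_localGauge10On`), def-P11's `Sect2.omegaPlaqsTop ∕ omegaBondsTop ∕ CoDivSmallOn`, def-K0's `plaqInside`.  THEOREMS-SIDE because the seat's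
filing rule is `--as helper` (Theorems only); the tokens are importable by the Summits-side closers of stub 1 (n21-c's `…K0HalvingStepSocket`).  COUNT-NEUTRAL.

WHY.  Print closes the one-step improvement of Sect. F (pp. 300–304 [PDF 24–28]) in two sentences (p. 304): having obtained (167) «|A|, |∇^ηA|, |∂^{η*}∂^ηA|,
|Δ^ηA| < ¼M_Δmax{B₃ε₁, ½ε₀} + ⅛M′ε₀ on Δ» in the gauge `u` of (152)–(159) around the unit cube `Δ = Δ₀` chosen for «a plaquette p, or a bond b … a unit cube
Δ₀ ⊂ B_j(Λ_j) containing p or b» (p. 302), *«This and the inequality (1.54) of [6] imply |U₁(∂p) − 1| < ε′ + 86dε′² < 2ε′ on Δ₀ (168) for ε′ small, similarly for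
|D^{η*}∂U₁|.  Again using the fact that U₁ is a gauge transformed U′_k on Δ₀, and that the conditions (2) are gauge invariant, we conclude that U′_k satisfies (2)
on Δ₀ with max{B₃ε₁, ½ε₀} instead of ε₀.  The cube Δ₀ is an arbitrary cube Δ(y) = B^j(y), if y ∈ Λ_j, hence U_k belongs to the space (2) with max{B₃ε₁, ½ε₀}
instead of ε₀.»*  The (168) step is n07-e's modules 31 ∕ 33c at the objects of record, with the tree's constants: a local gauge `Sect2.LocalGauge10On Y ξ t U`
(letters `< t`) gives (1.7) at `32·t·ξ²` on `plaqInside Y` and (1.9) at `2·t·ξ³` on `bondsDeep Y` when `0 < ξ ≤ 1`, `32·d·t ≤ 1`.  THIS FILE types the two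
sentences around it: (§1) the LOCATED INTERFACE the Sect. F chain (152)–(167) at objects must deliver — per plaquette ∕ per bond of the top class at level `m`, a
site set `Y ∋ p` (resp. `b` deep in `Y`) carrying a local gauge at the unit `η_i` of some level `i`, `m ≤ i ≤ k` (print's «Δ₀ ⊂ B_j(Λ_j)»: the supplier chooses
the level of the unit cube), with threshold `t`, `64·t ≤ max{B₃δ_i, ½ε_i}` (the tree's (168) constant `32` replaces print's «2ε′»; the factor is absorbed in `B₃` and
`a₅`, §3) —; (§2) «hence U_k belongs to the space (2) with max{B₃ε₁, ½ε₀}» AT EVERY LEVEL `m ≤ i` of the top class, by the level descent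
`max{B₃δ_i, ½ε_i}·η_i^p ≤ max{B₃δ_m, ½ε_m}·η_m^p` (`p ≥ 1`; two-sided 2-comparability of `δ`, `ε` and `L ≥ 2` — the typing n07-e's module 30 header LOCATED);
(§3) the (165) ⇒ (167) budget in the tree's constants: letters of the SHAPE (165) delivers at `M_Δ = 1` — linear in the data threshold (the `HB` chain
(160)–(161), print's `⅛B₃ε₁`) plus quadratic in the class radius (the `B₀(C₄ + 4C₂)(36dL²B₁R₁M₁)²ε₀²` terms) —, plus linear in the class radius with a SMALL coefficient (the far-site part of (161), small by (163)) —, `t = C·δ_i + θ·ε_i + Q·ε_i²`, meet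
`64·t ≤ max{B₃δ_i, ½ε_i}` as soon as `128·C ≤ B₃` (print's (162): «B₃ = 72d³L³B₀ sup sup Σ…», the constant is CHOSEN from the chain), `512·θ ≤ 1` (print's (163)
«B₃e^{−½δ₀R₁M₁} ≦ ½») and `512·Q·a₀ ≤ 1` (print's (166): «a largest absolute number a₅ such that … B₀(C₄ + 4C₂)(36dL²B₁R₁M₁)²a₅ ≦ ⅛»).

CONTENTS.  §0 plumbing (`η_i ∈ (0, 1]`, `η_{i+1} = η_i·L⁻¹`).  §1 ★★ `LocalLetters167TopStep F N Sup B₃ a₀ a₁` (def; NEVER asserted), `.of_le`.  §2 ★ `radius_descend`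
(the level descent), ★★ `halvingStepTop_of_localLetters167 : LocalLetters167TopStep F N Sup B₃ a₀ a₁ → 0 ≤ B₃ → 2·a₀ ≤ 1 → HalvingStepTop F N Sup B₃ a₀ a₁`.
§3 ★★ `LocalLetters165TopStep F N Sup B₃ C θ Q a₀ a₁` (def; NEVER asserted), `.of_le`, ★ `threshold167_of_budget165` (real arithmetic), ★ `localLetters167_of_localLetters165`,
★★ `halvingStepTop_of_localLetters165`.  §4 (the HEAD of the assembly, generic in the objects) `Letters10On Y ξ t X` (def: 33b's three letters of a bond field, no gauge),
`.of_le`, `grad_add_sub`, `curlA_add_sub`, `codiffCurlA_add_sub`, ★ `letters10On_of_eq159` («(164), the equality (159) and Eq. (158)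
imply (165)»: the letters are subadditive under `A = A₁ + HB − HD(A₁ + HB)`), ★ `localGauge10On_of_eq159` (gauge form).

READINGS displayed (unchanged from modules 30 ∕ 33c): criticality in the CURVE form (`IsCritOnFibre`; GAP-STATED(submersion)); LEVEL-DEPENDENT radii (module 30, LOCATED);
letters `|A|, |∇^ξA|, |∂^{ξ*}∂^ξA|` only (no Laplacian ∕ Hölder member — (8) needs neither); the level-`0` clauses (plaquettes ∕ bonds meeting `Ω₀ = Sup ν K s.Ω`) are part of the
token — on the PINNED plaquettes of `Sect2.printedPlaqsTop` a gauge of the datum `W 0` itself serves (print: (8)₀ off `Ω₁` is (7)); k0-s1-w3's `HalvingStepTopCore` cut composes.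
WHAT IS NOT HERE (honest scope): the tokens are NOT discharged — their discharge IS the Sect. F chain at objects (S3 (145)–(156), S4 (157)–(159), S5 (160)–(164)) fed into
§4; nothing of (152)–(167) is proved; the binder block of both tokens IS `HalvingStepTop`'s (inhabited: n07-e `…N07Prop8StepFlatWitness.halvingStepTop_binders_inhabited_flat`),
so §2–§3 are implications between NAMED HYPOTHESES of the printed shape, not discharges (A6: LOCATED — antecedent = the token).

HONEST FRAMING: displayed `Prop`s (never asserted) + kernel bookkeeping (real inequalities, an induction on the level gap, n07-e's (168) lemmas by name); NOTHING of
Bałaban's analysis is proved; `stub_prop8StepCoP13` ∕ K0⁷ ∕ K1⁷ NOT closed; N07 NOT discharged; counts unmoved (28∕28 · 5∕27); one finite T⁴ programme at fixed ε — R4 closes the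
conditional rung `BalabanLadder.UV` only, never the summit: NOT continuum ∕ ℝ⁴ ∕ OS ∕ mass gap ∕ Clay.  Three `def`s (two tokens + the letter predicate), no `instance`∕`notation`∕`sorry`.
-/

noncomputable section

namespace Summit.QuantumFields.YangMills.BalabanUVNodes.N07HalvingStepTopOfLocalLetters

open scoped Matrix.Norms.L2Operator
open Literature.MathematicalPhysics.QuantumFieldTheory.Balaban1983to89
open Literature.MathematicalPhysics.QuantumFieldTheory.Balaban1983to89.Node00
open Literature.MathematicalPhysics.QuantumFieldTheory.Balaban1983to89.T4Continuum (T4Family)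
open Literature.MathematicalPhysics.QuantumFieldTheory.Balaban1983to89.B15DeterminingSets
open Literature.MathematicalPhysics.QuantumFieldTheory.Balaban1983to89.B12RegularSpaces111 (gaugeU expI grad)

/-! ## §0  Plumbing: the units `η_i = L^{−i}` -/

section Eta

variable (P : Params)

/-- `0 < η_i ≤ 1` on the lattices of record (`η_i = L^{−i}`, `L ≥ 1`). [cite: Balaban1987RG1, (1.1) p.260 (bookkeeping)] -/
private theorem eta_pos_le_one' (i : ℕ) : 0 < P.eta i ∧ P.eta i ≤ 1 := by
  have hL : (1 : ℝ) ≤ P.L := by exact_mod_cast P.L_pos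
  unfold Params.eta
  exact ⟨pow_pos (inv_pos.mpr (lt_of_lt_of_le one_pos hL)) i, pow_le_one₀ (inv_nonneg.mpr (zero_le_one.trans hL)) (inv_le_one_of_one_le₀ hL)⟩

/-- `η_{i+1}^p ≤ ½·η_i^p` for `p ≥ 1` (`η_{i+1} = η_i∕L`, `L ≥ 2`). [cite: Balaban1987RG1, (1.1) p.260 (bookkeeping)] -/
private theorem eta_succ_pow_le_half (i : ℕ) {p : ℕ} (hp : 1 ≤ p) : P.eta (i + 1) ^ p ≤ 1 / 2 * P.eta i ^ p := by
  have hL2 : (2 : ℝ) ≤ P.L := by exact_mod_cast P.hL.2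
  have hη := (eta_pos_le_one' P i).1
  have hinv : (P.L : ℝ)⁻¹ ≤ 1 / 2 := by
    rw [inv_le_comm₀ (by linarith) (by norm_num)]; simpa using hL2
  have hinv0 : (0 : ℝ) ≤ (P.L : ℝ)⁻¹ := inv_nonneg.mpr (by linarith)
  have hsucc : P.eta (i + 1) = P.eta i * (P.L : ℝ)⁻¹ := by unfold Params.eta; rw [pow_succ]
  have hpow : ((P.L : ℝ)⁻¹) ^ p ≤ 1 / 2 := by
    calc ((P.L : ℝ)⁻¹) ^ p ≤ ((P.L : ℝ)⁻¹) ^ 1 := pow_le_pow_of_le_one hinv0 (hinv.trans (by norm_num)) hp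
      _ ≤ 1 / 2 := by simpa using hinv
  calc P.eta (i + 1) ^ p = P.eta i ^ p * ((P.L : ℝ)⁻¹) ^ p := by rw [hsucc, mul_pow]
    _ ≤ P.eta i ^ p * (1 / 2) := mul_le_mul_of_nonneg_left hpow (pow_nonneg hη.le p)
    _ = 1 / 2 * P.eta i ^ p := by ring

end Eta

/-! ## §1  ★★ The token: (167) in a local gauge around every plaquette ∕ bond of the top class -/

section Token167

variable (F : T4Family) (N : ℕ) [NeZero N]

/-- ★★ **[15] (167) IN A LOCAL GAUGE AROUND AN ARBITRARY UNIT CUBE, AT THE OBJECTS OF RECORD — TOKEN FORM** (the interface the Sect. F chain (144)–(167) delivers to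
the last two sentences of p. 304).  Binder block = n07-e's `HalvingStepTop F N Sup B₃ a₀ a₁` BYTE FOR BYTE (separated (2.18) index `s` with `0 < ν.M₁`, `1 ≤ k`; data
thresholds `0 < δ_n ≤ a₁` and class radii `B₃δ_n ≤ ε_n ≤ a₀`, both 2-comparable both ways; a (7)-regular datum `W` on the top-domain concord range; a configuration
`U` in the class (6) ON `Ω₀ = Sup ν K s.Ω` at radii `ε_n·η_n²` ∕ `ε_n·η_n³`, on the fibre of `W`, CRITICAL for (5) there).  CONCLUSION: for every level `m ≤ k`,
every plaquette `p` of the (1.7)-set `Sect2.omegaPlaqsTop s.Ω Ω₀ m` lies in `plaqInside Y`, and every bond `b` of the (1.9)-set `Sect2.omegaBondsTop s.Ω Ω₀ m` lies in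
`Sect2.bondsDeep Y`, for some site set `Y` (print's unit cube `Δ₀ ∋ p`, resp. `∋ b`, with its stencil) and some level `i`, `m ≤ i ≤ k` (print's «Δ₀ ⊂ B_j(Λ_j)»: the
level of the unit cube containing `p` — the supplier's choice), such that `U` carries a LOCAL GAUGE on `Y` at the unit `η_i` with print's three letters below a
threshold `t`, `Sect2.LocalGauge10On Y ((F.P K).eta i) t U` (33b: `(ι∘U)^{ι∘u} = e^{iη_iA}`, `‖A‖, ‖∇^{η_i}A‖ < t` on `Y`, `‖∂^{η_i*}∂^{η_i}A‖ < t` on the deep bonds),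
and `64·t ≤ max{B₃δ_i, ½ε_i}` — print's (167) «< ¼M_Δmax{B₃ε₁, ½ε₀} + ⅛M′ε₀ ≤ ε′ = ½max{…}» with the tree's (168) constant `32` (module 31) in place of print's
`1 + 86dε′ < 2`, absorbed into `B₃` and `a₅` (§3).  A `Prop`, NEVER asserted; its discharge is the Sect. F chain at objects (sub-targets S3–S5 + the (159) combination).
-- TODO(general form): ONE threshold ε₁ and ONE radius ε₀ in print; general admissible `{Ω_j}` ∕ `𝔅_k` of [6] Sect. A; print's (82) tangent criticality; print's (167)
-- carries also the Laplacian member `|Δ^ηA|`, not needed for (8).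
[cite: Balaban1985Variational, (167)–(168) p.304, p.302 («a unit cube Δ₀ ⊂ B_j(Λ_j) containing p or b»), Sect. F pp.300–304, (2)–(8) pp.278–279; Balaban1985RegularSpaces, (1.7)–(1.9) p.77, (1.54) p.85; Balaban1988Convergent, (2.6)–(2.8) pp.255–256, (2.12) p.256] -/
def LocalLetters167TopStep (Sup : (ν : Stage7Numerics) → (K : ℕ) → (ℕ → Set (Site (F.P K) 0)) → Set (Site (F.P K) 0)) (B₃ a₀ a₁ : ℝ) : Prop :=
  ∀ (ν : Stage7Numerics) (M : ℕ) (g : ℕ → ℝ) (K k : ℕ) (s : SeqOfRecord F ν M g K k), Sect2.SeqSeparated ν.M₁ s → 0 < ν.M₁ → 1 ≤ k →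
    ∀ (ε δ : ℕ → ℝ),
    (∀ n, n ≤ k → 0 < δ n ∧ δ n ≤ a₁) → (∀ n, n < k → δ n ≤ 2 * δ (n + 1)) → (∀ n, n < k → δ (n + 1) ≤ 2 * δ n) →
    (∀ n, n ≤ k → B₃ * δ n ≤ ε n ∧ ε n ≤ a₀) → (∀ n, n < k → ε n ≤ 2 * ε (n + 1)) → (∀ n, n < k → ε (n + 1) ≤ 2 * ε n) →
    ∀ W : MSField (F.P K) (SU N), Sect2.DataSmall7PTop (avOfRecord F N K) s.Ω (Sup ν K s.Ω) k δ W →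
      ∀ U : GaugeField (F.P K) 0 (SU N),
        (∀ n, n ≤ k → PlaqSmallOn (Sect2.omegaPlaqsTop s.Ω (Sup ν K s.Ω) n) (ε n * (F.P K).eta n ^ 2) U) →
        (∀ n, n ≤ k → Sect2.CoDivSmallOn (Sect2.omegaBondsTop s.Ω (Sup ν K s.Ω) n) (ε n * (F.P K).eta n ^ 3) U) →
        AgreeOn (genSet s.Ω k) (avgFamily (avOfRecord F N K) U) W →
        IsCritOnFibre F N K (genSet s.Ω k) W U →
        ∀ m, m ≤ k →
          (∀ p ∈ Sect2.omegaPlaqsTop s.Ω (Sup ν K s.Ω) m, ∃ (Y : Set (Site (F.P K) 0)) (i : ℕ) (t : ℝ), m ≤ i ∧ i ≤ k ∧ p ∈ plaqInside Y ∧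
              64 * t ≤ max (B₃ * δ i) (ε i / 2) ∧ Sect2.LocalGauge10On Y ((F.P K).eta i) t U) ∧
          (∀ b ∈ Sect2.omegaBondsTop s.Ω (Sup ν K s.Ω) m, ∃ (Y : Set (Site (F.P K) 0)) (i : ℕ) (t : ℝ), m ≤ i ∧ i ≤ k ∧ b ∈ Sect2.bondsDeep Y ∧
              64 * t ≤ max (B₃ * δ i) (ε i / 2) ∧ Sect2.LocalGauge10On Y ((F.P K).eta i) t U)

variable {F N}

/-- The token is ANTITONE in the ceilings `a₀`, `a₁` (its conclusion does not read them). [cite: Balaban1985Variational, (166)–(167) p.304 (bookkeeping)] -/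
theorem LocalLetters167TopStep.of_le {Sup : (ν : Stage7Numerics) → (K : ℕ) → (ℕ → Set (Site (F.P K) 0)) → Set (Site (F.P K) 0)} {B₃ a₀ a₀' a₁ a₁' : ℝ}
    (h : LocalLetters167TopStep F N Sup B₃ a₀ a₁) (ha₀ : a₀' ≤ a₀) (ha₁ : a₁' ≤ a₁) : LocalLetters167TopStep F N Sup B₃ a₀' a₁' :=
  fun ν M g K k s hsep hM₁ hk ε δ hδ hcomp hcomp' hε hεcomp hεcomp' W h7 U h17 h19 hfib hcrit =>
    h ν M g K k s hsep hM₁ hk ε δ (fun n hn => ⟨(hδ n hn).1, (hδ n hn).2.trans ha₁⟩) hcomp hcomp'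
      (fun n hn => ⟨(hε n hn).1, (hε n hn).2.trans ha₀⟩) hεcomp hεcomp' W h7 U h17 h19 hfib hcrit

end Token167

/-! ## §2  ★★ «Hence U_k belongs to the space (2) with max{B₃ε₁, ½ε₀} instead of ε₀»: the token closes `HalvingStepTop` -/

section Close

variable {F : T4Family} {N : ℕ} [NeZero N]

/-- ★ **THE LEVEL DESCENT of the improved radii**: with `B₃ ≥ 0`, positive data thresholds and BOTH families 2-comparable downwards (`δ_{n+1} ≤ 2δ_n`, `ε_{n+1} ≤ 2ε_n`
for `n < k`), the improved radius read at a deeper level `i ≤ k` in the units of that level is below the one at any level `m ≤ i`: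
`max{B₃δ_i, ½ε_i}·η_i^p ≤ max{B₃δ_m, ½ε_m}·η_m^p` for `p ≥ 1` — each level costs a factor `2` in the radius and gains `L^p ≥ 2`.  (This is why a gauge around a
unit cube of level `i ≥ m` serves the level-`m` clause of the class for a plaquette meeting `Ω_m`: n07-e module 30's LOCATED typing of the level-dependent radii.)
[cite: Balaban1985Variational, p.304 before Prop. 8, (2) p.278; Balaban1985RegularSpaces, (1.7)–(1.9) p.77; Balaban1988Convergent, (2.7)–(2.8) pp.255–256] -/
theorem radius_descend (P : Params) {k : ℕ} {B₃ : ℝ} (hB₃ : 0 ≤ B₃) {ε δ : ℕ → ℝ} (hδ : ∀ n, n ≤ k → 0 < δ n)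
    (hcomp' : ∀ n, n < k → δ (n + 1) ≤ 2 * δ n) (hεcomp' : ∀ n, n < k → ε (n + 1) ≤ 2 * ε n) {p : ℕ} (hp : 1 ≤ p) {m i : ℕ} (hmi : m ≤ i)
    (hik : i ≤ k) : max (B₃ * δ i) (ε i / 2) * P.eta i ^ p ≤ max (B₃ * δ m) (ε m / 2) * P.eta m ^ p := by
  obtain ⟨j, rfl⟩ := Nat.exists_eq_add_of_le hmi
  induction j with
  | zero => simp
  | succ j ih =>
    have hjk : m + j < k := by omega
    have hstep : max (B₃ * δ (m + j + 1)) (ε (m + j + 1) / 2) ≤ 2 * max (B₃ * δ (m + j)) (ε (m + j) / 2) := by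
      refine max_le ?_ ?_
      · calc B₃ * δ (m + j + 1) ≤ B₃ * (2 * δ (m + j)) := mul_le_mul_of_nonneg_left (hcomp' _ hjk) hB₃
          _ = 2 * (B₃ * δ (m + j)) := by ring
          _ ≤ 2 * max (B₃ * δ (m + j)) (ε (m + j) / 2) := by linarith [le_max_left (B₃ * δ (m + j)) (ε (m + j) / 2)]
      · calc ε (m + j + 1) / 2 ≤ 2 * (ε (m + j) / 2) := by linarith [hεcomp' _ hjk]
          _ ≤ 2 * max (B₃ * δ (m + j)) (ε (m + j) / 2) := by linarith [le_max_right (B₃ * δ (m + j)) (ε (m + j) / 2)]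
    have hr0 : 0 ≤ max (B₃ * δ (m + j)) (ε (m + j) / 2) :=
      le_max_of_le_left (mul_nonneg hB₃ (hδ _ hjk.le).le)
    have hη0 : 0 ≤ P.eta (m + j + 1) ^ p := pow_nonneg (eta_pos_le_one' P _).1.le p
    have hη := eta_succ_pow_le_half P (m + j) hp
    calc max (B₃ * δ (m + (j + 1))) (ε (m + (j + 1)) / 2) * P.eta (m + (j + 1)) ^ p
        = max (B₃ * δ (m + j + 1)) (ε (m + j + 1) / 2) * P.eta (m + j + 1) ^ p := by rw [← Nat.add_assoc]
      _ ≤ 2 * max (B₃ * δ (m + j)) (ε (m + j) / 2) * P.eta (m + j + 1) ^ p := mul_le_mul_of_nonneg_right hstep hη0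
      _ ≤ 2 * max (B₃ * δ (m + j)) (ε (m + j) / 2) * (1 / 2 * P.eta (m + j) ^ p) :=
          mul_le_mul_of_nonneg_left hη (mul_nonneg zero_le_two hr0)
      _ = max (B₃ * δ (m + j)) (ε (m + j) / 2) * P.eta (m + j) ^ p := by ring
      _ ≤ max (B₃ * δ m) (ε m / 2) * P.eta m ^ p := ih (Nat.le_add_right m j) (by omega)

/-- The two thresholds of the tree's (168) and its side condition from `64·t ≤ max{B₃δ_i, ½ε_i} ≤ ε_i ≤ a₀ ≤ ½` at `d = 4`: `32·t ≤ max{…}`, `2·t ≤ max{…}` and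
`32·d·t ≤ 1`. [cite: Balaban1985Variational, (166)–(168) p.304 (bookkeeping)] -/
private theorem thresholds168 {d : ℕ} (hd : d = 4) {B₃ δi εi a₀ t : ℝ} (hB₃ : 0 ≤ B₃) (hδi : 0 < δi) (hε : B₃ * δi ≤ εi ∧ εi ≤ a₀)
    (ha₀ : 2 * a₀ ≤ 1) (ht : 64 * t ≤ max (B₃ * δi) (εi / 2)) :
    32 * (d : ℝ) * t ≤ 1 ∧ 32 * t ≤ max (B₃ * δi) (εi / 2) ∧ 2 * t ≤ max (B₃ * δi) (εi / 2) := by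
  have hr0 : 0 ≤ max (B₃ * δi) (εi / 2) := le_max_of_le_left (mul_nonneg hB₃ hδi.le)
  have hε0 : 0 ≤ εi := (mul_nonneg hB₃ hδi.le).trans hε.1
  have hrε : max (B₃ * δi) (εi / 2) ≤ εi := max_le hε.1 (by linarith)
  subst hd
  push_cast
  by_cases h0 : 0 ≤ t
  · exact ⟨by linarith [hε.2], by linarith, by linarith⟩
  · have h0' : t < 0 := lt_of_not_ge h0
    exact ⟨by linarith, by linarith, by linarith⟩

/-- ★★ **«THE CUBE Δ₀ IS AN ARBITRARY CUBE … HENCE U_k BELONGS TO THE SPACE (2) WITH max{B₃ε₁, ½ε₀} INSTEAD OF ε₀» AT THE OBJECTS OF RECORD** ([15] p. 304, the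
last two sentences of the one-step improvement): the token `LocalLetters167TopStep F N Sup B₃ a₀ a₁` — (167) in a local gauge around every plaquette ∕ bond of the top
class — gives n07-e's `HalvingStepTop F N Sup B₃ a₀ a₁` for `B₃ ≥ 0` and `a₀ ≤ ½`: per plaquette (resp. bond) the local gauge at unit `η_i` yields (1.7) at
`32·t·η_i²` on `plaqInside Y` and (1.9) at `2·t·η_i³` on `bondsDeep Y` (33c `Sect2.regularTwo_of_localGauge10On`, side condition `32·d·t ≤ 1` from `t ≤ a₀∕64`,
`d = 4`), `64·t ≤ max{B₃δ_i, ½ε_i}` puts both below the improved radius at level `i`, and the level descent `radius_descend` carries it to the level `m ≤ i` at which the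
clause is read.  By module 30 (`prop8RegSepTopStep_of_halvingStepTop`) and n21-c's socket this is ALSO «token ⇒ stub 1» by name; the token is a HYPOTHESIS here.
[cite: Balaban1985Variational, (167)–(168) p.304, p.302, Prop. 8 p.304, (2)–(8) pp.278–279; Balaban1985RegularSpaces, (1.7)–(1.9) p.77, (1.54) p.85, Prop. 7 (1.144) p.100] -/
theorem halvingStepTop_of_localLetters167 {Sup : (ν : Stage7Numerics) → (K : ℕ) → (ℕ → Set (Site (F.P K) 0)) → Set (Site (F.P K) 0)}
    {B₃ a₀ a₁ : ℝ} (h : LocalLetters167TopStep F N Sup B₃ a₀ a₁) (hB₃ : 0 ≤ B₃) (ha₀ : 2 * a₀ ≤ 1) :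
    HalvingStepTop F N Sup B₃ a₀ a₁ := by
  intro ν M g K k s hsep hM₁ hk ε δ hδ hcomp hcomp' hε hεcomp hεcomp' W h7 U h17 h19 hfib hcrit
  have htok := h ν M g K k s hsep hM₁ hk ε δ hδ hcomp hcomp' hε hεcomp hεcomp' W h7 U h17 h19 hfib hcrit
  have hδpos : ∀ n, n ≤ k → 0 < δ n := fun n hn => (hδ n hn).1
  refine ⟨fun m hm p hp => ?_, fun m hm b hb => ?_⟩
  · obtain ⟨Y, i, t, hmi, hik, hpY, ht, hg⟩ := (htok m hm).1 p hp
    obtain ⟨hd, h32, -⟩ := thresholds168 (T4Family.P_d F K) hB₃ (hδpos i hik) (hε i hik) ha₀ ht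
    have hη := eta_pos_le_one' (F.P K) i
    have h1 := (Sect2.regularTwo_of_localGauge10On hg hη.1 hη.2 hd).1 p hpY
    calc dist1 (GaugeField.plaqHol U p) < 32 * t * (F.P K).eta i ^ 2 := h1
      _ ≤ max (B₃ * δ i) (ε i / 2) * (F.P K).eta i ^ 2 := mul_le_mul_of_nonneg_right h32 (pow_nonneg hη.1.le 2)
      _ ≤ max (B₃ * δ m) (ε m / 2) * (F.P K).eta m ^ 2 := radius_descend (F.P K) hB₃ hδpos hcomp' hεcomp' one_le_two hmi hik
  · obtain ⟨Y, i, t, hmi, hik, hbY, ht, hg⟩ := (htok m hm).2 b hb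
    obtain ⟨hd, -, h2⟩ := thresholds168 (T4Family.P_d F K) hB₃ (hδpos i hik) (hε i hik) ha₀ ht
    have hη := eta_pos_le_one' (F.P K) i
    have h1 := (Sect2.regularTwo_of_localGauge10On hg hη.1 hη.2 hd).2 b hbY
    calc ‖Sect2.coDivSum U b.src b.dir‖ < 2 * t * (F.P K).eta i ^ 3 := h1
      _ ≤ max (B₃ * δ i) (ε i / 2) * (F.P K).eta i ^ 3 := mul_le_mul_of_nonneg_right h2 (pow_nonneg hη.1.le 3)
      _ ≤ max (B₃ * δ m) (ε m / 2) * (F.P K).eta m ^ 3 :=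
          radius_descend (F.P K) hB₃ hδpos hcomp' hεcomp' (by norm_num) hmi hik

end Close

/-! ## §3  ★★ The (165) ⇒ (167) budget in the tree's constants: print's (162) «B₃» and (166) «a₅» -/

section Budget165

variable (F : T4Family) (N : ℕ) [NeZero N]

/-- ★★ **[15] (165) AT `M_Δ = 1` IN A LOCAL GAUGE AROUND AN ARBITRARY UNIT CUBE — TOKEN FORM** (the shape the Sect. F chain delivers BEFORE the budget (166)–(167) is
cut): the binder block of `HalvingStepTop F N Sup B₃ a₀ a₁` BYTE FOR BYTE and the same per-plaquette ∕ per-bond ∃-gauge conclusion as `LocalLetters167TopStep`, with the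
threshold of the local gauge at the unit `η_i` EQUAL TO `C·δ_i + θ·ε_i + Q·ε_i²` — print's (165) «¼M_Δmax{B₃ε₁, ½ε₀} + B₀C₄(36dL²B₁Mε₀)² + B₀4C₂(36dL²B₁Mε₀)²» at `M_Δ = 1`
read as what the chain actually produces: a term LINEAR IN THE DATA THRESHOLD (the near-site part of the `HB` chain (160)–(161) p. 303, whose constant DEFINES `B₃` in (162):
`C` plays «⅛B₃»), a term LINEAR IN THE CLASS RADIUS WITH A SMALL COEFFICIENT (the FAR-site part of (161): there only the class bound (155) «|B| < 18d²L³Mε₀» is available and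
(163) «B₃e^{−½δ₀R₁M₁} ≦ ½» makes the coefficient small — `θ` plays «⅛·B₃e^{−½δ₀R₁M₁}», the slot k0-s1-w3's LOCATED-S5-1 asked for), plus a term QUADRATIC IN THE CLASS RADIUS
(the `𝔊 = HD(A′)` and Prop. 6 terms, `Q` plays «B₀(C₄ + 4C₂)(36dL²B₁R₁M₁)²» = n07-c's `K165`).  A `Prop`, NEVER asserted.
-- TODO(general form): as for `LocalLetters167TopStep`; print's (165) also bounds `|Δ^ηA|`.
[cite: Balaban1985Variational, (160)–(165) pp.303–304, (162)–(163) pp.303–304, Sect. F pp.300–304; Balaban1985RegularSpaces, (1.7)–(1.9) p.77; Balaban1988Convergent, (2.12) p.256] -/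
def LocalLetters165TopStep (Sup : (ν : Stage7Numerics) → (K : ℕ) → (ℕ → Set (Site (F.P K) 0)) → Set (Site (F.P K) 0)) (B₃ C θ Q a₀ a₁ : ℝ) : Prop :=
  ∀ (ν : Stage7Numerics) (M : ℕ) (g : ℕ → ℝ) (K k : ℕ) (s : SeqOfRecord F ν M g K k), Sect2.SeqSeparated ν.M₁ s → 0 < ν.M₁ → 1 ≤ k →
    ∀ (ε δ : ℕ → ℝ),
    (∀ n, n ≤ k → 0 < δ n ∧ δ n ≤ a₁) → (∀ n, n < k → δ n ≤ 2 * δ (n + 1)) → (∀ n, n < k → δ (n + 1) ≤ 2 * δ n) →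
    (∀ n, n ≤ k → B₃ * δ n ≤ ε n ∧ ε n ≤ a₀) → (∀ n, n < k → ε n ≤ 2 * ε (n + 1)) → (∀ n, n < k → ε (n + 1) ≤ 2 * ε n) →
    ∀ W : MSField (F.P K) (SU N), Sect2.DataSmall7PTop (avOfRecord F N K) s.Ω (Sup ν K s.Ω) k δ W →
      ∀ U : GaugeField (F.P K) 0 (SU N),
        (∀ n, n ≤ k → PlaqSmallOn (Sect2.omegaPlaqsTop s.Ω (Sup ν K s.Ω) n) (ε n * (F.P K).eta n ^ 2) U) →
        (∀ n, n ≤ k → Sect2.CoDivSmallOn (Sect2.omegaBondsTop s.Ω (Sup ν K s.Ω) n) (ε n * (F.P K).eta n ^ 3) U) →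
        AgreeOn (genSet s.Ω k) (avgFamily (avOfRecord F N K) U) W →
        IsCritOnFibre F N K (genSet s.Ω k) W U →
        ∀ m, m ≤ k →
          (∀ p ∈ Sect2.omegaPlaqsTop s.Ω (Sup ν K s.Ω) m, ∃ (Y : Set (Site (F.P K) 0)) (i : ℕ), m ≤ i ∧ i ≤ k ∧ p ∈ plaqInside Y ∧
              Sect2.LocalGauge10On Y ((F.P K).eta i) (C * δ i + θ * ε i + Q * ε i ^ 2) U) ∧
          (∀ b ∈ Sect2.omegaBondsTop s.Ω (Sup ν K s.Ω) m, ∃ (Y : Set (Site (F.P K) 0)) (i : ℕ), m ≤ i ∧ i ≤ k ∧ b ∈ Sect2.bondsDeep Y ∧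
              Sect2.LocalGauge10On Y ((F.P K).eta i) (C * δ i + θ * ε i + Q * ε i ^ 2) U)

variable {F N}

/-- The (165)-token is ANTITONE in the ceilings `a₀`, `a₁`. [cite: Balaban1985Variational, (165)–(166) p.304 (bookkeeping)] -/
theorem LocalLetters165TopStep.of_le {Sup : (ν : Stage7Numerics) → (K : ℕ) → (ℕ → Set (Site (F.P K) 0)) → Set (Site (F.P K) 0)}
    {B₃ C θ Q a₀ a₀' a₁ a₁' : ℝ} (h : LocalLetters165TopStep F N Sup B₃ C θ Q a₀ a₁) (ha₀ : a₀' ≤ a₀) (ha₁ : a₁' ≤ a₁) :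
    LocalLetters165TopStep F N Sup B₃ C θ Q a₀' a₁' :=
  fun ν M g K k s hsep hM₁ hk ε δ hδ hcomp hcomp' hε hεcomp hεcomp' W h7 U h17 h19 hfib hcrit =>
    h ν M g K k s hsep hM₁ hk ε δ (fun n hn => ⟨(hδ n hn).1, (hδ n hn).2.trans ha₁⟩) hcomp hcomp'
      (fun n hn => ⟨(hε n hn).1, (hε n hn).2.trans ha₀⟩) hεcomp hεcomp' W h7 U h17 h19 hfib hcrit

/-- ★ **PRINT'S (162) «B₃», (163) AND (166) «a₅» IN THE TREE'S CONSTANTS** (real arithmetic): a letter bound `C·δ + θ·ε + Q·ε²` — linear in the data threshold `δ > 0`,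
linear in the class radius `0 ≤ ε ≤ a₀` with a small coefficient `θ ≤ 1∕512`, quadratic in it with `Q ≥ 0` — is at most `max{B₃δ, ½ε}∕64` as soon as `128·C ≤ B₃` (the
data part is half the budget: `64Cδ ≤ ½B₃δ`), `512·θ ≤ 1` (`64θε ≤ ⅛ε`) and `512·Q·a₀ ≤ 1` (`64Qε² ≤ 64Qa₀ε ≤ ⅛ε`).  Print: «B₃ = 72d³L³B₀ sup sup Σ…» (162), «B₃e^{−½δ₀R₁M₁} ≦ ½»
(163), «We take a largest absolute number a₅ such that … B₀(C₄ + 4C₂)(36dL²B₁R₁M₁)²a₅ ≦ ⅛» (166) — the constants are CHOSEN from the chain; here with the factor `64 = 32·2` of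
the tree's (168). [cite: Balaban1985Variational, (162)–(163) pp.303–304, (165)–(167) p.304] -/
theorem threshold167_of_budget165 {B₃ C θ Q a₀ δ ε : ℝ} (hC : 128 * C ≤ B₃) (hθ' : 512 * θ ≤ 1) (hQ : 0 ≤ Q)
    (ha : 512 * Q * a₀ ≤ 1) (hδ : 0 < δ) (hε0 : 0 ≤ ε) (hεa : ε ≤ a₀) : 64 * (C * δ + θ * ε + Q * ε ^ 2) ≤ max (B₃ * δ) (ε / 2) := by
  have hlin : 64 * (C * δ) ≤ 1 / 2 * (B₃ * δ) := by nlinarith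
  have hθε : 64 * (θ * ε) ≤ 1 / 4 * (ε / 2) := by nlinarith
  have hquad : 64 * (Q * ε ^ 2) ≤ 1 / 4 * (ε / 2) := by
    have h1 : Q * ε ^ 2 ≤ Q * a₀ * ε := by
      have := mul_le_mul_of_nonneg_left hεa (mul_nonneg hQ hε0)
      nlinarith
    have h2 : 64 * (Q * a₀ * ε) ≤ 1 / 8 * ε := by nlinarith
    linarith
  have hm1 := le_max_left (B₃ * δ) (ε / 2)
  have hm2 := le_max_right (B₃ * δ) (ε / 2)
  calc 64 * (C * δ + θ * ε + Q * ε ^ 2) = 64 * (C * δ) + 64 * (θ * ε) + 64 * (Q * ε ^ 2) := by ring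
    _ ≤ 1 / 2 * (B₃ * δ) + 1 / 4 * (ε / 2) + 1 / 4 * (ε / 2) := add_le_add (add_le_add hlin hθε) hquad
    _ ≤ 1 / 2 * max (B₃ * δ) (ε / 2) + 1 / 4 * max (B₃ * δ) (ε / 2) + 1 / 4 * max (B₃ * δ) (ε / 2) := by
        gcongr
    _ = max (B₃ * δ) (ε / 2) := by ring

/-- ★ **(165) ⇒ (167) AT THE OBJECTS OF RECORD**: the (165)-token with constants `C`, `θ ≤ 1∕512`, `Q ≥ 0` gives the (167)-token at the same ceilings whenever
`128·C ≤ B₃` and `512·Q·a₀ ≤ 1` — per plaquette ∕ bond the same `Y`, the same level `i`, the same gauge, the threshold `t := C·δ_i + θ·ε_i + Q·ε_i²` meeting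
`64·t ≤ max{B₃δ_i, ½ε_i}` by `threshold167_of_budget165` (`0 ≤ ε_i ≤ a₀` from the binders and `B₃ ≥ 0`).
[cite: Balaban1985Variational, (165)–(167) p.304, (162)–(163) pp.303–304, (166) p.304] -/
theorem localLetters167_of_localLetters165 {Sup : (ν : Stage7Numerics) → (K : ℕ) → (ℕ → Set (Site (F.P K) 0)) → Set (Site (F.P K) 0)}
    {B₃ C θ Q a₀ a₁ : ℝ} (h : LocalLetters165TopStep F N Sup B₃ C θ Q a₀ a₁) (hB₃ : 0 ≤ B₃) (hC : 128 * C ≤ B₃) (hθ' : 512 * θ ≤ 1)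
    (hQ : 0 ≤ Q) (ha : 512 * Q * a₀ ≤ 1) : LocalLetters167TopStep F N Sup B₃ a₀ a₁ := by
  intro ν M g K k s hsep hM₁ hk ε δ hδ hcomp hcomp' hε hεcomp hεcomp' W h7 U h17 h19 hfib hcrit m hm
  have htok := h ν M g K k s hsep hM₁ hk ε δ hδ hcomp hcomp' hε hεcomp hεcomp' W h7 U h17 h19 hfib hcrit m hm
  have hbud : ∀ i, i ≤ k → 64 * (C * δ i + θ * ε i + Q * ε i ^ 2) ≤ max (B₃ * δ i) (ε i / 2) := fun i hi =>
    threshold167_of_budget165 hC hθ' hQ ha (hδ i hi).1 ((mul_nonneg hB₃ (hδ i hi).1.le).trans (hε i hi).1) (hε i hi).2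
  refine ⟨fun p hp => ?_, fun b hb => ?_⟩
  · obtain ⟨Y, i, hmi, hik, hpY, hg⟩ := htok.1 p hp
    exact ⟨Y, i, C * δ i + θ * ε i + Q * ε i ^ 2, hmi, hik, hpY, hbud i hik, hg⟩
  · obtain ⟨Y, i, hmi, hik, hbY, hg⟩ := htok.2 b hb
    exact ⟨Y, i, C * δ i + θ * ε i + Q * ε i ^ 2, hmi, hik, hbY, hbud i hik, hg⟩

/-- ★★ **THE (165)-LETTERS CLOSE THE ONE-STEP IMPROVEMENT** (composition of §3 with §2): the (165)-token with `B₃ ≥ max{128C, 0}`, `θ ≤ 1∕512` (print's (163)),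
`Q ≥ 0`, at ceilings `a₀ ≤ ½` with `512·Q·a₀ ≤ 1` (print's «ε₀ ≦ a₅») gives n07-e's `HalvingStepTop F N Sup B₃ a₀ a₁` — hence, by module 30 and n21-c's socket, stub 1's `Prop8RegSepTopStep` at the same
constants.  The token is a HYPOTHESIS; this is an implication between named statements of the printed shape, not a discharge.
[cite: Balaban1985Variational, (165)–(168) p.304, (162) p.303, Prop. 8 p.304; Balaban1985RegularSpaces, (1.7)–(1.9) p.77, (1.54) p.85] -/
theorem halvingStepTop_of_localLetters165 {Sup : (ν : Stage7Numerics) → (K : ℕ) → (ℕ → Set (Site (F.P K) 0)) → Set (Site (F.P K) 0)}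
    {B₃ C θ Q a₀ a₁ : ℝ} (h : LocalLetters165TopStep F N Sup B₃ C θ Q a₀ a₁) (hB₃ : 0 ≤ B₃) (hC : 128 * C ≤ B₃) (hθ' : 512 * θ ≤ 1)
    (hQ : 0 ≤ Q) (ha : 512 * Q * a₀ ≤ 1) (ha₀ : 2 * a₀ ≤ 1) : HalvingStepTop F N Sup B₃ a₀ a₁ :=
  halvingStepTop_of_localLetters167 (localLetters167_of_localLetters165 h hB₃ hC hθ' hQ ha) hB₃ ha₀

end Budget165

/-! ## §4  ★ The HEAD of the assembly: «(164), the equality (159) and Eq. (158) imply (165)» — the three letters are subadditive under `A = A₁ + HB − HD(A₁ + HB)` -/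

section Combination159

variable {P : Params} {N : ℕ}

/-- **PRINT'S THREE LETTERS OF A POTENTIAL ON A SITE SET, BELOW ONE THRESHOLD** (the letter block of 33b's `Sect2.LocalGauge10On` WITHOUT the gauge equation, for an
arbitrary `M_N(ℂ)`-valued bond field `X` — the currency in which the Sect. F chain bounds the three summands of (159) separately: `HB` by (160)–(161), `A₁` and
`HD(A₁ + HB)` by (158), (55), (164)): `‖X(b)‖ < t` on the bonds of `Y`, `‖∇^ξ_μX_ν(x)‖ < t` on the derivative stencils of `Y`, `‖(∂^{ξ*}∂^ξX)(b)‖ < t` on the deep bonds of `Y`.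
[cite: Balaban1985Variational, (159)–(165) pp.303–304, Thm 1 (9)–(10) p.279; Balaban1985RegularSpaces, (1.140) p.100] -/
def Letters10On (Y : Set (Site P 0)) (ξ t : ℝ) (X : PBond P 0 → MatA N) : Prop :=
  (∀ b ∈ (Sect2.regionOfSet P Y).bonds, ‖X b‖ < t) ∧
    (∀ q ∈ (Sect2.regionOfSet P Y).dpairs, ‖grad ξ q.2.1 (fun y => X ⟨y, q.2.2⟩) q.1‖ < t) ∧
    ∀ b ∈ Sect2.bondsDeep Y, ‖Sect2.codiffCurlA ξ X b.src b.dir‖ < t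

/-- Monotone in the threshold. [cite: Balaban1985Variational, (165) p.304 (bookkeeping)] -/
theorem Letters10On.of_le {Y : Set (Site P 0)} {ξ t t' : ℝ} {X : PBond P 0 → MatA N} (h : Letters10On Y ξ t X) (ht : t ≤ t') :
    Letters10On Y ξ t' X :=
  ⟨fun b hb => (h.1 b hb).trans_le ht, fun q hq => (h.2.1 q hq).trans_le ht, fun b hb => (h.2.2 b hb).trans_le ht⟩

/-- `∇^ξ` is additive-subtractive: `∇^ξ_μ(F₁ + F₂ − F₃) = ∇^ξ_μF₁ + ∇^ξ_μF₂ − ∇^ξ_μF₃`. [cite: Balaban1987RG1, (1.12) p.262 (bookkeeping)] -/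
theorem grad_add_sub {i : ℕ} (ξ : ℝ) (μ : Fin P.d) (F₁ F₂ F₃ : Site P i → MatA N) (x : Site P i) :
    grad ξ μ (fun y => F₁ y + F₂ y - F₃ y) x = grad ξ μ F₁ x + grad ξ μ F₂ x - grad ξ μ F₃ x := by
  simp only [grad, smul_sub, smul_add]
  abel

/-- `∂^ξ` is additive-subtractive in the potential. [cite: Balaban1985RegularSpaces, (1.2) p.76 (bookkeeping)] -/
theorem curlA_add_sub {i : ℕ} (ξ : ℝ) (A₁ A₂ A₃ : PBond P i → MatA N) (y : Site P i) (ν μ : Fin P.d) :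
    Sect2.curlA ξ (fun b => A₁ b + A₂ b - A₃ b) y ν μ = Sect2.curlA ξ A₁ y ν μ + Sect2.curlA ξ A₂ y ν μ - Sect2.curlA ξ A₃ y ν μ := by
  simp only [Sect2.curlA, grad, smul_sub, smul_add]
  abel

/-- `∂^{ξ*}∂^ξ` is additive-subtractive in the potential. [cite: Balaban1985RegularSpaces, (1.2) p.76 (bookkeeping)] -/
theorem codiffCurlA_add_sub {i : ℕ} (ξ : ℝ) (A₁ A₂ A₃ : PBond P i → MatA N) (x : Site P i) (μ : Fin P.d) :
    Sect2.codiffCurlA ξ (fun b => A₁ b + A₂ b - A₃ b) x μ =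
      Sect2.codiffCurlA ξ A₁ x μ + Sect2.codiffCurlA ξ A₂ x μ - Sect2.codiffCurlA ξ A₃ x μ := by
  simp only [Sect2.codiffCurlA, curlA_add_sub, smul_sub, smul_add, Finset.sum_sub_distrib, Finset.sum_add_distrib]
  abel

/-- `‖a + b − c‖ < t₁ + t₂ + t₃` from `‖a‖ < t₁`, `‖b‖ < t₂`, `‖c‖ < t₃`. [folklore] -/
private theorem norm_add_sub_lt {E : Type*} [SeminormedAddCommGroup E] {a b c : E} {t₁ t₂ t₃ : ℝ} (ha : ‖a‖ < t₁) (hb : ‖b‖ < t₂)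
    (hc : ‖c‖ < t₃) : ‖a + b - c‖ < t₁ + t₂ + t₃ := by
  linarith [norm_sub_le (a + b) c, norm_add_le a b]

/-- ★ **THE LETTERS OF (159)'s `A = A₁ + HB − HD(A₁ + HB)` ARE BELOW THE SUM OF THE LETTERS OF ITS THREE SUMMANDS** — print p. 304: *«This bound [(164) on HB], the
equality (159) and Eq. (158) [for A₁] imply |A|, |∇^ηA|, |∂^{η*}∂^ηA|, |Δ^ηA| < … (165)»*: for bond fields with `A = A₁ + A₂ − A₃` on ALL bonds (the tree's letters read
neighbours, so the identity is asked pointwise, as (159) is) and `Letters10On Y ξ tᵢ Aᵢ`, the combined field has `Letters10On Y ξ (t₁ + t₂ + t₃) A` — the three letters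
are built from `∇^ξ` and finite sums, hence additive.  The object-level inputs (the bounds on `HB`, `A₁`, `HD(A₁ + HB)` in the gauge of (152)–(157)) are S5 ∕ S4 ∕ S3.
[cite: Balaban1985Variational, (159) p.303, (164)–(165) p.304; Balaban1985RegularSpaces, (1.2) p.76] -/
theorem letters10On_of_eq159 {Y : Set (Site P 0)} {ξ t₁ t₂ t₃ : ℝ} {A A₁ A₂ A₃ : PBond P 0 → MatA N} (hA : ∀ b, A b = A₁ b + A₂ b - A₃ b)
    (h₁ : Letters10On Y ξ t₁ A₁) (h₂ : Letters10On Y ξ t₂ A₂) (h₃ : Letters10On Y ξ t₃ A₃) : Letters10On Y ξ (t₁ + t₂ + t₃) A := by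
  have hA' : A = fun b => A₁ b + A₂ b - A₃ b := funext hA
  subst hA'
  refine ⟨fun b hb => ?_, fun q hq => ?_, fun b hb => ?_⟩
  · exact norm_add_sub_lt (h₁.1 b hb) (h₂.1 b hb) (h₃.1 b hb)
  · have : grad ξ q.2.1 (fun y => A₁ ⟨y, q.2.2⟩ + A₂ ⟨y, q.2.2⟩ - A₃ ⟨y, q.2.2⟩) q.1 =
        grad ξ q.2.1 (fun y => A₁ ⟨y, q.2.2⟩) q.1 + grad ξ q.2.1 (fun y => A₂ ⟨y, q.2.2⟩) q.1 - grad ξ q.2.1 (fun y => A₃ ⟨y, q.2.2⟩) q.1 :=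
      grad_add_sub ξ q.2.1 _ _ _ q.1
    rw [this]
    exact norm_add_sub_lt (h₁.2.1 q hq) (h₂.2.1 q hq) (h₃.2.1 q hq)
  · rw [codiffCurlA_add_sub]
    exact norm_add_sub_lt (h₁.2.2 b hb) (h₂.2.2 b hb) (h₃.2.2 b hb)

/-- ★ **THE HEAD OF S6, GAUGE FORM**: a gauge `u` of `U` on `Y` whose potential is (159)'s combination `A = A₁ + A₂ − A₃` of three bond fields with letters below `t₁`,
`t₂`, `t₃` gives 33b's clause `Sect2.LocalGauge10On Y ξ (t₁ + t₂ + t₃) U` — the (165)-shaped local gauge the tokens of §1 ∕ §3 ask for, at `t₁ + t₂ + t₃ ≤ C·δ_i +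
θ·ε_i + Q·ε_i²` once S5 bounds `HB` (linear in the data + the small far-site class term) and S4 bounds `A₁`, `HD(A₁ + HB)` quadratically in the class radius.
[cite: Balaban1985Variational, (152) p.301, (157)–(159) pp.302–303, (165) p.304] -/
theorem localGauge10On_of_eq159 [NeZero N] {Y : Set (Site P 0)} {ξ t₁ t₂ t₃ : ℝ} {U : GaugeField P 0 (SU N)} (u : GaugeTransf P 0 (SU N))
    {A A₁ A₂ A₃ : PBond P 0 → MatA N}
    (he : ∀ b ∈ (Sect2.regionOfSet P Y).bonds, gaugeU (fun x => ιSU N (u x)) (fun b' => ιSU N (U b')) b = expI ξ (A b))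
    (hA : ∀ b, A b = A₁ b + A₂ b - A₃ b) (h₁ : Letters10On Y ξ t₁ A₁) (h₂ : Letters10On Y ξ t₂ A₂) (h₃ : Letters10On Y ξ t₃ A₃) :
    Sect2.LocalGauge10On Y ξ (t₁ + t₂ + t₃) U :=
  have hL := letters10On_of_eq159 hA h₁ h₂ h₃
  ⟨u, A, he, hL.1, hL.2.1, hL.2.2⟩

end Combination159

end Summit.QuantumFields.YangMills.BalabanUVNodes.N07HalvingStepTopOfLocalLetters

end
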